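import Literature.Computability.Cryptography.ChenQuantumLWENonDemolition

/-!
# Digit observers of the Step-9 register: the line-translation symmetry bound (T17)

REPRODUCTION / ANALYSIS OF A CLAIMED RESULT UNDER ADJUDICATION (withdrawn): Yilei Chen, *Quantum
Algorithms for Lattice Problems*, IACR ePrint 2024/555, version of 2024-04-18 [ChenQuantumLattice2024]
(the version carrying the author's note that Step 9 contains a bug), Step 9 (§3.5.9, pp. 34–38) acting
on the line ket `|φ8.b⟩ = Σ_{j ∈ ℤ_P} ψ_P(−j²) |2D²j·b + v′ mod N⟩` (p. 35), with the secret
`b = [−1, 2p₁sᵀ, 2p₁eᵀ]ᵀ` of eq. (12) (p. 17) and the Step-8 value `v′₀ mod D²p₁` of Claim 3.14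
(pp. 33–34).  Bundle `papers/QuantumAdvantage/lwe-quantum-autopsy/`, Part 2 (`REPAIR-CENSUS.md` §26,
theorem **T17**, census row G7), sequel of `ChenQuantumLWENonDemolition.lean` (whose `lineShift`,
`ptB_lineShift` it uses) and of `ChenQuantumLWEDatumPrior.lean` / `ChenQuantumLWEJointDatumPrior.lean`
(T15/T16: the value of the register under a prior on the SECRET; here the prior is on the OFFSET).
HONEST FRAMING: kernel-checked THEOREMS about the measurement statistics of states occurring in a
WITHDRAWN algorithm — an elementary symmetry bound that VOIDS one described repair mechanism (the
instance-aware "digit observer" of census row G7, items (B2)/(B3)), NOT summit progress, no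
cryptanalytic claim in either direction, no new algorithm; quantum lower bounds are out of scope.

## What is proved

**A. The symmetry lemma** (`card_mul_guessSuccess_le`, pure probability, no quantum content).  A hidden
variable `v` with an arbitrary real "law" `L` (no sign or normalisation needed) is observed through a
stochastic kernel `m v ·` and a datum `a v ∈ A` is guessed by an arbitrary randomised rule `g o ·`.  If a
family `σ_i` (`i ∈ ι`) of bijections of the hidden-variable space PRESERVES THE KERNEL (`m (σ_i v) = m v`)
and CYCLES THE DATUM (`i ↦ a (σ_i v)` is a bijection onto `A` for every `v`), then
`#ι · success ≤ Σ_v L v + Σ_i defect(L, σ_i)` with `defect(L, σ) = Σ_v (L(σ v) − L v)⁺`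
(`lawShiftDefect`); for a law invariant under the family the success is at most `1/#ι = 1/#A`, the blind
value.  `lawShiftDefect_indicator`: for the uniform law on a set `R` the defect is
`#{v ∉ R : σ v ∈ R} / #R` — the probability that the translate leaves the support.

**B. The Step-9 register** (`digitObserver_card_mul_le`, `digitObserver_le`,
`digitObserver_le_inv_of_invariant`, and the residue model `residueObserver_le`).  For odd `P = p₁Q`,
`b₀ = −1` and `2D²p₁` a unit mod `Q` (Chen's admissible shapes), take ANY finite hidden-variable space
`V` carrying the offset `off v ∈ ℤ^{n+1}`, ANY law `L` on it, ANY side information `f v` (the instance,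
the secret, Chen's `k′`, the Step-8 value `v′₀ mod D²p₁` — `toStep8_lineShift_p₁_mul` — …) and ANY
family of bijections `σ_k` (`k ∈ ℤ_Q`) acting on the offset as the LINE TRANSLATION by `p₁t_k` steps,
`v′ ↦ v′ + 2D²(p₁t_k)·b (mod N)`, `t_k ≡ k (mod Q)` (any complete residue system), leaving `f` invariant.
Then the computational-basis Born law of `|φ_{b,v′}⟩` (uniform on the `P` distinct points of the line:
`weight_phi8bKet_ptB`, `weight_phi8bKet_of_forall_ne`, `sum_weight_phi8bKet`) is INVARIANT under every
`σ_k` (`weight_phi8bKet_lineShift`: the translate is the same line with a re-indexed unimodular chirp —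
`phi8bKet_lineShift` of `ChenQuantumLWENonDemolition`), the datum `v′₀ mod Q` is CYCLED
(`k ↦ a − 2D²p₁·k`, a bijection of `ℤ_Q`), and therefore EVERY observer that measures the register in
the computational basis (all coordinates; any coarse-graining or post-processing is a randomised rule
`g`) and holds `f v` guesses the datum with probability at most
`(Σ_v L v + Σ_{k ∈ ℤ_Q} defect(L, σ_k)) / Q`; at most `1/Q`, the blind value, when the law of the
offset has mass `1` and is translation invariant along the line.  The census (§26) evaluates the defect BY HAND for Chen's law
(the offset is the canonical lift of a uniform element of the `q`-ary lattice `Λ/qΛ′`; the defect of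
`σ_k` is the probability that a translate by `2Dp₁t_k·b` leaves the box `[0,q)^n`,
`≤ 2Dp₁|t_k|·‖b‖₁/q`) — the instance-aware "consistency test" of row G7 (B3) and the "label pinning" of
(B2) are digit observers, hence VOID up to that wrap-around term.

## What is NOT here

Coherent (non-diagonal) instance-aware measurements of the register — the translates
`|φ_{b,v′}⟩`, `|φ_{b,v′+2D²p₁t·b}⟩` are DISTINCT (indeed orthogonal for `p₁t ≢ 0 mod P`) states on
the same line, so no law-symmetry argument bounds observers that do not pass through the
computational-basis statistics (census row G7 stays OPEN for them, with no described mechanism left);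
the by-hand wrap-around estimate for Chen's offset law; LWE/LWR reductions ([BGMRR16], census (B3)).
-/

namespace Literature.Computability.Cryptography.Chen2024

open scoped BigOperators

/-! ### A. The symmetry lemma -/

section Symmetry

variable {V O A ι : Type*} [Fintype V] [Fintype O] [Fintype A] [Fintype ι]

/-- Success weight of guessing the datum `a v` of a hidden variable `v` with law `L`, observed through
the kernel `m v ·`, with the randomised guessing rule `g o ·` (a law on `A` per observation `o`):
`Σ_v L(v) Σ_o m(v,o) g(o, a v)`. [folklore] -/
def guessSuccess (L : V → ℝ) (m : V → O → ℝ) (g : O → A → ℝ) (a : V → A) : ℝ :=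
  ∑ v, L v * ∑ o, m v o * g o (a v)

/-- The DEFECT of the law `L` under the map `σ` of the hidden-variable space:
`Σ_v (L(σ v) − L(v))⁺` — for a law invariant under `σ` it is `0`, for the uniform law on a set `R` and a
bijection `σ` it is the probability that `σ` moves a point of `R` out of `R`
(`lawShiftDefect_indicator`). [folklore] -/
def lawShiftDefect (L : V → ℝ) (σ : V → V) : ℝ :=
  ∑ v, max (L (σ v) - L v) 0

/-- The defect is non-negative. [folklore] -/
theorem lawShiftDefect_nonneg (L : V → ℝ) (σ : V → V) : 0 ≤ lawShiftDefect L σ :=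
  Finset.sum_nonneg fun _ _ => le_max_right _ _

/-- An invariant law has defect `0`. [folklore] -/
theorem lawShiftDefect_of_invariant (L : V → ℝ) (σ : V → V) (h : ∀ v, L (σ v) = L v) :
    lawShiftDefect L σ = 0 := by
  simp [lawShiftDefect, h]

/-- The defect of (a multiple `c ≥ 0` of) the indicator law of a set `R`: `c · #{v ∉ R : σ v ∈ R}`.
For the uniform law (`c = 1/#R`) and a bijection `σ` this is the probability that `σ⁻¹` (equivalently,
by bijectivity, `σ`) moves a uniform point of `R` out of `R`. [folklore] -/
theorem lawShiftDefect_indicator [DecidableEq V] (R : Finset V) (σ : V → V) {c : ℝ} (hc : 0 ≤ c) :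
    lawShiftDefect (fun v => if v ∈ R then c else 0) σ
      = c * ((Finset.univ.filter fun v => σ v ∈ R ∧ v ∉ R).card : ℝ) := by
  classical
  unfold lawShiftDefect
  have hterm : ∀ v, max ((if σ v ∈ R then c else 0) - if v ∈ R then c else 0) 0
      = if σ v ∈ R ∧ v ∉ R then c else 0 := by
    intro v
    by_cases h1 : σ v ∈ R <;> by_cases h2 : v ∈ R <;> simp [h1, h2, hc]
  simp_rw [hterm]
  rw [Finset.sum_ite, Finset.sum_const_zero, add_zero, Finset.sum_const, nsmul_eq_mul, mul_comm]

/-- **The symmetry lemma.**  If a family `σ_i` of bijections of the hidden-variable space preserves the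
observation kernel and cycles the datum through all of `A`, then
`#ι · success ≤ Σ_v L(v) + Σ_i defect(L, σ_i)` — for EVERY randomised guessing rule.  (Proof: re-index
the success sum by each `σ_i`, pay the defect to move the law back, and note that the `#ι` re-indexed
rules guess, between them, every value of the datum exactly once.) [folklore] -/
theorem card_mul_guessSuccess_le (L : V → ℝ) (m : V → O → ℝ) (g : O → A → ℝ) (a : V → A)
    (hm : ∀ v o, 0 ≤ m v o) (hm1 : ∀ v, ∑ o, m v o = 1)
    (hg : ∀ o a', 0 ≤ g o a') (hg1 : ∀ o, ∑ a', g o a' = 1)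
    (σ : ι → V → V) (hσ : ∀ i, Function.Bijective (σ i))
    (hsym : ∀ i v o, m (σ i v) o = m v o)
    (hbij : ∀ v, Function.Bijective fun i => a (σ i v)) :
    (Fintype.card ι : ℝ) * guessSuccess L m g a ≤ (∑ v, L v) + ∑ i, lawShiftDefect L (σ i) := by
  -- the success of the `i`-th re-indexed rule on the hidden variable `v`
  set c : ι → V → ℝ := fun i v => ∑ o, m v o * g o (a (σ i v)) with hc
  have c_nonneg : ∀ i v, 0 ≤ c i v := fun i v =>
    Finset.sum_nonneg fun o _ => mul_nonneg (hm v o) (hg o _)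
  have g_le_one : ∀ o a', g o a' ≤ 1 := fun o a' =>
    (Finset.single_le_sum (fun a'' _ => hg o a'') (Finset.mem_univ a')).trans (hg1 o).le
  have c_le_one : ∀ i v, c i v ≤ 1 := fun i v =>
    calc c i v ≤ ∑ o, m v o * 1 :=
          Finset.sum_le_sum fun o _ => mul_le_mul_of_nonneg_left (g_le_one _ _) (hm v o)
      _ = 1 := by rw [← Finset.sum_mul, hm1 v, one_mul]
  -- step 1: re-index the success sum by `σ i` and use the symmetry of the kernel
  have step1 : ∀ i, guessSuccess L m g a = ∑ v, L (σ i v) * c i v := by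
    intro i
    unfold guessSuccess
    rw [← (hσ i).sum_comp (fun v => L v * ∑ o, m v o * g o (a v))]
    refine Finset.sum_congr rfl fun v _ => ?_
    simp only [hc, hsym i v]
  -- step 2: move the law back, paying the defect
  have step2 : ∀ i, guessSuccess L m g a ≤ (∑ v, L v * c i v) + lawShiftDefect L (σ i) := by
    intro i
    rw [step1 i, lawShiftDefect, ← Finset.sum_add_distrib]
    refine Finset.sum_le_sum fun v _ => ?_
    have h1 : L (σ i v) ≤ L v + max (L (σ i v) - L v) 0 := by
      rcases le_total (L (σ i v) - L v) 0 with h | h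
      · rw [max_eq_right h]; linarith
      · rw [max_eq_left h]; linarith
    have h2 : max (L (σ i v) - L v) 0 * c i v ≤ max (L (σ i v) - L v) 0 :=
      mul_le_of_le_one_right (le_max_right _ _) (c_le_one i v)
    calc L (σ i v) * c i v ≤ (L v + max (L (σ i v) - L v) 0) * c i v :=
          mul_le_mul_of_nonneg_right h1 (c_nonneg i v)
      _ = L v * c i v + max (L (σ i v) - L v) 0 * c i v := by ring
      _ ≤ L v * c i v + max (L (σ i v) - L v) 0 := by linarith
  -- step 3: between them, the re-indexed rules guess every datum value exactly once
  have step3 : ∀ v, ∑ i, c i v = 1 := by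
    intro v
    simp only [hc]
    rw [Finset.sum_comm]
    have h : ∀ o, ∑ i, m v o * g o (a (σ i v)) = m v o := fun o => by
      rw [← Finset.mul_sum, (hbij v).sum_comp (g o), hg1 o, mul_one]
    simp only [h, hm1 v]
  calc (Fintype.card ι : ℝ) * guessSuccess L m g a = ∑ _i : ι, guessSuccess L m g a := by
        rw [Finset.sum_const, Finset.card_univ, nsmul_eq_mul]
    _ ≤ ∑ i, ((∑ v, L v * c i v) + lawShiftDefect L (σ i)) := Finset.sum_le_sum fun i _ => step2 i
    _ = (∑ v, L v * ∑ i, c i v) + ∑ i, lawShiftDefect L (σ i) := by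
        rw [Finset.sum_add_distrib, Finset.sum_comm]
        congr 1
        exact Finset.sum_congr rfl fun v _ => by rw [Finset.mul_sum]
    _ = (∑ v, L v) + ∑ i, lawShiftDefect L (σ i) := by simp only [step3, mul_one]

/-- The symmetry lemma, divided through: `success ≤ (Σ_v L v + Σ_i defect(L,σ_i)) / #ι`. [folklore] -/
theorem guessSuccess_le_div [Nonempty ι] (L : V → ℝ) (m : V → O → ℝ) (g : O → A → ℝ) (a : V → A)
    (hm : ∀ v o, 0 ≤ m v o) (hm1 : ∀ v, ∑ o, m v o = 1)
    (hg : ∀ o a', 0 ≤ g o a') (hg1 : ∀ o, ∑ a', g o a' = 1)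
    (σ : ι → V → V) (hσ : ∀ i, Function.Bijective (σ i))
    (hsym : ∀ i v o, m (σ i v) o = m v o)
    (hbij : ∀ v, Function.Bijective fun i => a (σ i v)) :
    guessSuccess L m g a ≤ ((∑ v, L v) + ∑ i, lawShiftDefect L (σ i)) / Fintype.card ι := by
  rw [le_div_iff₀ (Nat.cast_pos.2 Fintype.card_pos), mul_comm]
  exact card_mul_guessSuccess_le L m g a hm hm1 hg hg1 σ hσ hsym hbij

/-- For a law of mass `1` INVARIANT under the family, the success is at most the blind value `1/#ι`
(`= 1/#A`: the datum is cycled bijectively). [folklore] -/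
theorem guessSuccess_le_inv_of_invariant [Nonempty ι] (L : V → ℝ) (m : V → O → ℝ) (g : O → A → ℝ)
    (a : V → A) (hL1 : ∑ v, L v = 1)
    (hm : ∀ v o, 0 ≤ m v o) (hm1 : ∀ v, ∑ o, m v o = 1)
    (hg : ∀ o a', 0 ≤ g o a') (hg1 : ∀ o, ∑ a', g o a' = 1)
    (σ : ι → V → V) (hσ : ∀ i, Function.Bijective (σ i))
    (hsym : ∀ i v o, m (σ i v) o = m v o)
    (hbij : ∀ v, Function.Bijective fun i => a (σ i v))
    (hinv : ∀ i v, L (σ i v) = L v) :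
    guessSuccess L m g a ≤ 1 / Fintype.card ι := by
  have h := guessSuccess_le_div L m g a hm hm1 hg hg1 σ hσ hsym hbij
  have h0 : ∑ i, lawShiftDefect L (σ i) = 0 :=
    Finset.sum_eq_zero fun i _ => lawShiftDefect_of_invariant L (σ i) (hinv i)
  rwa [h0, add_zero, hL1] at h

end Symmetry

/-! ### B. The computational-basis law of `|φ_{b,v′}⟩` and its invariance under line translations -/

/-- A sum over a finite type of a function vanishing off the range of an injective parametrisation is the
sum over the parameters. [folklore] -/
theorem sum_eq_sum_of_injective_support {κ X M : Type*} [Fintype κ] [Fintype X] [DecidableEq X]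
    [AddCommMonoid M] {pt : κ → X} (hpt : Function.Injective pt) (F : X → M)
    (hF : ∀ x, (∀ j, x ≠ pt j) → F x = 0) : ∑ x, F x = ∑ j, F (pt j) := by
  rw [← Finset.sum_image (f := F) (s := Finset.univ) (g := pt) fun j _ j' _ h => hpt h]
  symm
  refine Finset.sum_subset (Finset.subset_univ _) fun x _ hx => hF x fun j h => hx ?_
  exact Finset.mem_image.2 ⟨j, Finset.mem_univ _, h.symm⟩

section Register

variable (n : ℕ) (D p₁ Q : ℕ+) (b : Fin (n + 1) → ℤ)

/-- The Born weight of `|φ_{b,v′}⟩` at a point of its line is `1` (odd `P`, `b₀ = −1`: the points are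
distinct and the chirp is unimodular). [cite: ChenQuantumLattice2024, §3.5.9 p. 35] -/
theorem weight_phi8bKet_ptB (hP : Odd ((p₁ * Q : ℕ+) : ℕ)) (hb : b 0 = -1)
    (v' : Fin (n + 1) → ℤ) (j : ZP p₁ Q) :
    weight (phi8bKet n D p₁ Q b v') (ptB n D p₁ Q b v' j) = 1 := by
  rw [weight, phi8bKet_eq_profileKet, profileKet_apply_ptB n D p₁ Q b v' hP hb, ZMod.stdAddChar_apply,
    Circle.norm_coe, one_pow]

/-- The Born weight of `|φ_{b,v′}⟩` off its line is `0`. [cite: ChenQuantumLattice2024, §3.5.9 p. 35] -/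
theorem weight_phi8bKet_of_forall_ne (v' : Fin (n + 1) → ℤ) {o : Fin (n + 1) → ZN D p₁ Q}
    (ho : ∀ j, o ≠ ptB n D p₁ Q b v' j) : weight (phi8bKet n D p₁ Q b v') o = 0 := by
  have h : phi8bKet n D p₁ Q b v' o = 0 := by
    unfold phi8bKet
    exact lineKet_apply_of_ne _ _ ho
  rw [weight, h, norm_zero, zero_pow two_ne_zero]

/-- The total Born weight of `|φ_{b,v′}⟩` is `P` (so its computational-basis LAW is `weight/P`,
uniform on the `P` points of the line). [cite: ChenQuantumLattice2024, §3.5.9 p. 35] -/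
theorem sum_weight_phi8bKet (hP : Odd ((p₁ * Q : ℕ+) : ℕ)) (hb : b 0 = -1)
    (v' : Fin (n + 1) → ℤ) :
    ∑ o, weight (phi8bKet n D p₁ Q b v') o = ((p₁ * Q : ℕ+) : ℕ) := by
  classical
  rw [sum_eq_sum_of_injective_support (ptB_injective n D p₁ Q b v' hP hb)
    (fun o => weight (phi8bKet n D p₁ Q b v') o)
    (fun o ho => weight_phi8bKet_of_forall_ne n D p₁ Q b v' ho)]
  simp only [weight_phi8bKet_ptB n D p₁ Q b hP hb v', Finset.sum_const, Finset.card_univ, ZMod.card,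
    nsmul_eq_mul, mul_one]

/-- **Invariance of the computational-basis law under line translations.**  Moving the offset `s`
steps along the line (`v′ ↦ v′ + 2D²s·b`) does not change any Born weight of `|φ_{b,v′}⟩` in the
computational basis: the translate is the same line carrying a re-indexed unimodular chirp
(`phi8bKet_lineShift`). [cite: ChenQuantumLattice2024, §3.5.9 p. 35] -/
theorem weight_phi8bKet_lineShift (hP : Odd ((p₁ * Q : ℕ+) : ℕ)) (hb : b 0 = -1)
    (v' : Fin (n + 1) → ℤ) (s : ℤ) (o : Fin (n + 1) → ZN D p₁ Q) :
    weight (phi8bKet n D p₁ Q b (lineShift n D b v' s)) o = weight (phi8bKet n D p₁ Q b v') o := by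
  classical
  by_cases h : ∃ j, o = ptB n D p₁ Q b v' j
  · obtain ⟨j, rfl⟩ := h
    have e : ptB n D p₁ Q b v' j = ptB n D p₁ Q b (lineShift n D b v' s) (j - ((s : ℤ) : ZP p₁ Q)) := by
      rw [ptB_lineShift, sub_add_cancel]
    rw [weight_phi8bKet_ptB n D p₁ Q b hP hb v' j, e,
      weight_phi8bKet_ptB n D p₁ Q b hP hb (lineShift n D b v' s)]
  · push Not at h
    rw [weight_phi8bKet_of_forall_ne n D p₁ Q b v' h]
    refine weight_phi8bKet_of_forall_ne n D p₁ Q b _ fun j hj => ?_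
    rw [ptB_lineShift] at hj
    exact h _ hj

/-- Offsets that agree coordinatewise mod `N` have the same line. [folklore] -/
theorem ptB_congr_mod {v' v'' : Fin (n + 1) → ℤ}
    (h : ∀ i, ((v' i : ℤ) : ZN D p₁ Q) = ((v'' i : ℤ) : ZN D p₁ Q)) :
    ptB n D p₁ Q b v' = ptB n D p₁ Q b v'' := by
  funext j i
  simp only [ptB, Int.cast_add, h]

/-- Offsets that agree coordinatewise mod `N` have the same `|φ_{b,v′}⟩`. [folklore] -/
theorem phi8bKet_congr_mod {v' v'' : Fin (n + 1) → ℤ}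
    (h : ∀ i, ((v' i : ℤ) : ZN D p₁ Q) = ((v'' i : ℤ) : ZN D p₁ Q)) :
    phi8bKet n D p₁ Q b v' = phi8bKet n D p₁ Q b v'' := by
  unfold phi8bKet
  rw [ptB_congr_mod n D p₁ Q b h]

/-! ### The datum `v′₀ mod Q` and the Step-8 value `v′₀ mod D²p₁` under line translations by `p₁t` steps -/

/-- The reduction `ℤ_N → ℤ_Q` (`N = D²p₁Q`): applied to coordinate `0` of the offset it is the DATUM
`v′₀ mod Q` that Step 9 needs and Steps 1–8 do not supply (census O1). [cite: ChenQuantumLattice2024,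
§3.5.9 pp. 36–37] -/
def toDatum : ZN D p₁ Q →+* ZQ Q :=
  ZMod.castHom (⟨D * D * p₁, by push_cast; ring⟩ : ((Q : ℕ+) : ℕ) ∣ ((D * D * (p₁ * Q) : ℕ+) : ℕ))
    (ZQ Q)

/-- `toDatum` of an integer. [folklore] -/
theorem toDatum_intCast (z : ℤ) : toDatum D p₁ Q ((z : ℤ) : ZN D p₁ Q) = ((z : ℤ) : ZQ Q) :=
  map_intCast _ z

/-- A line translation by `p₁t` steps moves the datum by `2D²p₁t·b₀ = −2D²p₁·t (mod Q)`.
[cite: ChenQuantumLattice2024, §3.5.9 p. 35, eq. (12) p. 17] -/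
theorem toDatum_lineShift_p₁_mul (hb : b 0 = -1) (v' : Fin (n + 1) → ℤ) (s : ℤ) :
    toDatum D p₁ Q ((lineShift n D b v' (((p₁ : ℕ) : ℤ) * s) 0 : ℤ) : ZN D p₁ Q)
      = toDatum D p₁ Q ((v' 0 : ℤ) : ZN D p₁ Q) - ((2 * D * D * p₁ : ℕ) : ZQ Q) * ((s : ℤ) : ZQ Q) := by
  simp only [toDatum_intCast, lineShift, hb]
  push_cast
  ring

/-- A line translation by `p₁t` steps does NOT move the Step-8 value `v′₀ mod D²p₁`
(`2D²p₁t·b₀ ≡ 0`). [cite: ChenQuantumLattice2024, Claim 3.14 pp. 33–34, §3.5.9 p. 35] -/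
theorem toStep8_lineShift_p₁_mul (v' : Fin (n + 1) → ℤ) (s : ℤ) :
    toStep8 D p₁ Q ((lineShift n D b v' (((p₁ : ℕ) : ℤ) * s) 0 : ℤ) : ZN D p₁ Q)
      = toStep8 D p₁ Q ((v' 0 : ℤ) : ZN D p₁ Q) := by
  have hd : ((D * D * p₁ : ℕ+) : ℕ) ∣ (D : ℕ) * (D : ℕ) * (p₁ : ℕ) :=
    ⟨1, by rw [mul_one, PNat.mul_coe, PNat.mul_coe]⟩
  have h0 : (((D : ℕ) * (D : ℕ) * (p₁ : ℕ) : ℕ) : ZMod ((D * D * p₁ : ℕ+) : ℕ)) = 0 :=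
    (CharP.cast_eq_zero_iff (ZMod ((D * D * p₁ : ℕ+) : ℕ)) ((D * D * p₁ : ℕ+) : ℕ) _).2 hd
  simp only [Nat.cast_mul] at h0
  simp only [toStep8_intCast, lineShift]
  simp only [Int.cast_add, Int.cast_mul, Int.cast_ofNat, Int.cast_pow, Int.cast_natCast]
  linear_combination (2 * ((s : ℤ) : ZMod ((D * D * p₁ : ℕ+) : ℕ))
    * ((b 0 : ℤ) : ZMod ((D * D * p₁ : ℕ+) : ℕ))) * h0

/-! ### The digit observer -/

section Observer

variable {V Sd : Type*} [DecidableEq Sd]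

/-- The observation kernel of a DIGIT OBSERVER: the hidden variable `v` (carrying the offset `off v`)
is seen through the computational-basis measurement of ALL coordinates of the Step-9 register
`|φ_{b, off v}⟩` (law `weight/P`) together with the side information `f v`.
[cite: ChenQuantumLattice2024, §3.5.9 pp. 35–37] -/
noncomputable def digitKernel (off : V → Fin (n + 1) → ℤ) (f : V → Sd) (v : V)
    (o : (Fin (n + 1) → ZN D p₁ Q) × Sd) : ℝ :=
  weight (phi8bKet n D p₁ Q b (off v)) o.1 / (((p₁ * Q : ℕ+) : ℕ) : ℝ) * if o.2 = f v then 1 else 0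

/-- The digit kernel is non-negative. [folklore] -/
theorem digitKernel_nonneg (off : V → Fin (n + 1) → ℤ) (f : V → Sd) (v : V)
    (o : (Fin (n + 1) → ZN D p₁ Q) × Sd) : 0 ≤ digitKernel n D p₁ Q b off f v o := by
  unfold digitKernel weight
  exact mul_nonneg (div_nonneg (sq_nonneg _) (Nat.cast_nonneg _)) (by split_ifs <;> norm_num)

variable [Fintype Sd]

/-- The digit kernel is a law (total mass `1`). [folklore] -/
theorem sum_digitKernel (hP : Odd ((p₁ * Q : ℕ+) : ℕ)) (hb : b 0 = -1)
    (off : V → Fin (n + 1) → ℤ) (f : V → Sd) (v : V) :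
    ∑ o, digitKernel n D p₁ Q b off f v o = 1 := by
  rw [Fintype.sum_prod_type]
  simp only [digitKernel]
  simp_rw [← Finset.mul_sum, Finset.sum_ite_eq' Finset.univ (f v), if_pos (Finset.mem_univ _), mul_one,
    ← Finset.sum_div, sum_weight_phi8bKet n D p₁ Q b hP hb]
  exact div_self (by positivity)

variable [Fintype V]

/-- Any complete residue system indexed by its residues will do for `t` below; the canonical one is
`k ↦ k.val`. [folklore] -/
theorem intCast_val_eq_self (k : ZQ Q) : (((k.val : ℕ) : ℤ) : ZQ Q) = k := by
  rw [Int.cast_natCast, ZMod.natCast_zmod_val]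

/-- **T17 — digit observers are blind up to the defect of the offset law.**  Odd `P = p₁Q`, `b₀ = −1`,
`2D²p₁` a unit mod `Q`; `t` any complete residue system mod `Q`; `V` any finite hidden-variable space
with offset `off`, acted on by bijections `σ_k` (`k ∈ ℤ_Q`) that translate the offset by `p₁t_k` steps
along the line (mod `N`) and fix the side information `f`; `L` ANY real function on `V` (the law of the
hidden variable; no hypothesis); `g` ANY randomised guessing rule.  Then
`Q · success ≤ Σ_v L v + Σ_k defect(L, σ_k)`.  [cite: ChenQuantumLattice2024, §3.5.9 pp. 35–37,
eq. (12) p. 17, Claim 3.14 pp. 33–34] -/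
theorem digitObserver_card_mul_le (hP : Odd ((p₁ * Q : ℕ+) : ℕ)) (hb : b 0 = -1)
    (hunit : IsUnit ((2 * D * D * p₁ : ℕ) : ZQ Q))
    (t : ZQ Q → ℤ) (ht : ∀ k, ((t k : ℤ) : ZQ Q) = k)
    (off : V → Fin (n + 1) → ℤ) (σ : ZQ Q → V → V) (hσ : ∀ k, Function.Bijective (σ k))
    (hoff : ∀ k v i, ((off (σ k v) i : ℤ) : ZN D p₁ Q)
      = ((lineShift n D b (off v) (((p₁ : ℕ) : ℤ) * t k) i : ℤ) : ZN D p₁ Q))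
    (f : V → Sd) (hf : ∀ k v, f (σ k v) = f v)
    (L : V → ℝ) (g : (Fin (n + 1) → ZN D p₁ Q) × Sd → ZQ Q → ℝ)
    (hg : ∀ o a', 0 ≤ g o a') (hg1 : ∀ o, ∑ a', g o a' = 1) :
    ((Q : ℕ) : ℝ) * guessSuccess L (digitKernel n D p₁ Q b off f) g
        (fun v => toDatum D p₁ Q ((off v 0 : ℤ) : ZN D p₁ Q))
      ≤ (∑ v, L v) + ∑ k, lawShiftDefect L (σ k) := by
  -- symmetry of the kernel
  have hsym : ∀ k v o, digitKernel n D p₁ Q b off f (σ k v) o = digitKernel n D p₁ Q b off f v o := by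
    intro k v o
    have hk : phi8bKet n D p₁ Q b (off (σ k v))
        = phi8bKet n D p₁ Q b (lineShift n D b (off v) (((p₁ : ℕ) : ℤ) * t k)) :=
      phi8bKet_congr_mod n D p₁ Q b (hoff k v)
    simp only [digitKernel, hf k v, hk, weight_phi8bKet_lineShift n D p₁ Q b hP hb]
  -- the datum is cycled
  have hform : ∀ k v, toDatum D p₁ Q ((off (σ k v) 0 : ℤ) : ZN D p₁ Q)
      = toDatum D p₁ Q ((off v 0 : ℤ) : ZN D p₁ Q) - ((2 * D * D * p₁ : ℕ) : ZQ Q) * k := by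
    intro k v
    rw [hoff k v 0, toDatum_lineShift_p₁_mul n D p₁ Q b hb, ht k]
  have hbij : ∀ v, Function.Bijective fun k => toDatum D p₁ Q ((off (σ k v) 0 : ℤ) : ZN D p₁ Q) := by
    intro v
    refine Finite.injective_iff_bijective.1 fun k k' hkk' => ?_
    simp only [hform] at hkk'
    exact hunit.mul_left_cancel (sub_right_injective hkk')
  have key := card_mul_guessSuccess_le L (digitKernel n D p₁ Q b off f) g
    (fun v => toDatum D p₁ Q ((off v 0 : ℤ) : ZN D p₁ Q))
    (digitKernel_nonneg n D p₁ Q b off f) (sum_digitKernel n D p₁ Q b hP hb off f) hg hg1 σ hσ hsym hbij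
  simpa only [ZMod.card] using key

/-- T17 divided through: `success ≤ (Σ_v L v + Σ_k defect(L, σ_k)) / Q`.
[cite: ChenQuantumLattice2024, §3.5.9 pp. 35–37] -/
theorem digitObserver_le (hP : Odd ((p₁ * Q : ℕ+) : ℕ)) (hb : b 0 = -1)
    (hunit : IsUnit ((2 * D * D * p₁ : ℕ) : ZQ Q))
    (t : ZQ Q → ℤ) (ht : ∀ k, ((t k : ℤ) : ZQ Q) = k)
    (off : V → Fin (n + 1) → ℤ) (σ : ZQ Q → V → V) (hσ : ∀ k, Function.Bijective (σ k))
    (hoff : ∀ k v i, ((off (σ k v) i : ℤ) : ZN D p₁ Q)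
      = ((lineShift n D b (off v) (((p₁ : ℕ) : ℤ) * t k) i : ℤ) : ZN D p₁ Q))
    (f : V → Sd) (hf : ∀ k v, f (σ k v) = f v)
    (L : V → ℝ) (g : (Fin (n + 1) → ZN D p₁ Q) × Sd → ZQ Q → ℝ)
    (hg : ∀ o a', 0 ≤ g o a') (hg1 : ∀ o, ∑ a', g o a' = 1) :
    guessSuccess L (digitKernel n D p₁ Q b off f) g (fun v => toDatum D p₁ Q ((off v 0 : ℤ) : ZN D p₁ Q))
      ≤ ((∑ v, L v) + ∑ k, lawShiftDefect L (σ k)) / ((Q : ℕ) : ℝ) := by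
  rw [le_div_iff₀ (by positivity), mul_comm]
  exact digitObserver_card_mul_le n D p₁ Q b hP hb hunit t ht off σ hσ hoff f hf L g hg hg1

/-- T17 for a translation-invariant offset law of mass `1`: EVERY digit observer guesses the datum
with probability at most the blind value `1/Q`. [cite: ChenQuantumLattice2024, §3.5.9 pp. 35–37] -/
theorem digitObserver_le_inv_of_invariant (hP : Odd ((p₁ * Q : ℕ+) : ℕ)) (hb : b 0 = -1)
    (hunit : IsUnit ((2 * D * D * p₁ : ℕ) : ZQ Q))
    (t : ZQ Q → ℤ) (ht : ∀ k, ((t k : ℤ) : ZQ Q) = k)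
    (off : V → Fin (n + 1) → ℤ) (σ : ZQ Q → V → V) (hσ : ∀ k, Function.Bijective (σ k))
    (hoff : ∀ k v i, ((off (σ k v) i : ℤ) : ZN D p₁ Q)
      = ((lineShift n D b (off v) (((p₁ : ℕ) : ℤ) * t k) i : ℤ) : ZN D p₁ Q))
    (f : V → Sd) (hf : ∀ k v, f (σ k v) = f v)
    (L : V → ℝ) (hL1 : ∑ v, L v = 1) (hinv : ∀ k v, L (σ k v) = L v)
    (g : (Fin (n + 1) → ZN D p₁ Q) × Sd → ZQ Q → ℝ)
    (hg : ∀ o a', 0 ≤ g o a') (hg1 : ∀ o, ∑ a', g o a' = 1) :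
    guessSuccess L (digitKernel n D p₁ Q b off f) g (fun v => toDatum D p₁ Q ((off v 0 : ℤ) : ZN D p₁ Q))
      ≤ 1 / ((Q : ℕ) : ℝ) := by
  have h := digitObserver_le n D p₁ Q b hP hb hunit t ht off σ hσ hoff f hf L g hg hg1
  have h0 : ∑ k, lawShiftDefect L (σ k) = 0 :=
    Finset.sum_eq_zero fun k _ => lawShiftDefect_of_invariant L (σ k) (hinv k)
  rwa [h0, add_zero, hL1] at h

end Observer

/-! ### The residue model: offsets mod `N`, translations of `ℤ_N^{n+1}` -/

section Residue

/-- The canonical integer lift of a residue vector. [folklore] -/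
def liftV (x : Fin (n + 1) → ZN D p₁ Q) : Fin (n + 1) → ℤ := fun i => (((x i).val : ℕ) : ℤ)

/-- Casting the lift back gives the residue. [folklore] -/
theorem intCast_liftV (x : Fin (n + 1) → ZN D p₁ Q) (i : Fin (n + 1)) :
    ((liftV n D p₁ Q x i : ℤ) : ZN D p₁ Q) = x i := by
  simp only [liftV, Int.cast_natCast, ZMod.natCast_zmod_val]

/-- The line translation by `p₁t_k` steps as a vector of `ℤ_N^{n+1}`: `2D²(p₁t_k)·b mod N`.
[cite: ChenQuantumLattice2024, §3.5.9 p. 35] -/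
def shiftVec (t : ZQ Q → ℤ) (k : ZQ Q) : Fin (n + 1) → ZN D p₁ Q :=
  fun i => ((2 * ((D : ℕ) : ℤ) ^ 2 * (((p₁ : ℕ) : ℤ) * t k) * b i : ℤ) : ZN D p₁ Q)

/-- The line translation acting on residue offsets. [cite: ChenQuantumLattice2024, §3.5.9 p. 35] -/
def residueShift (t : ZQ Q → ℤ) (k : ZQ Q) (x : Fin (n + 1) → ZN D p₁ Q) : Fin (n + 1) → ZN D p₁ Q :=
  x + shiftVec n D p₁ Q b t k

/-- The residue translation is a bijection. [folklore] -/
theorem residueShift_bijective (t : ZQ Q → ℤ) (k : ZQ Q) :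
    Function.Bijective (residueShift n D p₁ Q b t k) :=
  (Equiv.addRight (shiftVec n D p₁ Q b t k)).bijective

/-- The residue translation lifts to the integer line translation mod `N`. [folklore] -/
theorem intCast_liftV_residueShift (t : ZQ Q → ℤ) (k : ZQ Q) (x : Fin (n + 1) → ZN D p₁ Q)
    (i : Fin (n + 1)) :
    ((liftV n D p₁ Q (residueShift n D p₁ Q b t k x) i : ℤ) : ZN D p₁ Q)
      = ((lineShift n D b (liftV n D p₁ Q x) (((p₁ : ℕ) : ℤ) * t k) i : ℤ) : ZN D p₁ Q) := by
  rw [intCast_liftV]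
  simp only [residueShift, shiftVec, Pi.add_apply, lineShift, Int.cast_add, intCast_liftV]

/-- **T17 in the residue model.**  Hidden variable = the offset mod `N` with ANY law `L` on `ℤ_N^{n+1}`,
translations `x ↦ x + 2D²(p₁t_k)·b`, side information any translation-invariant `f` (e.g. the Step-8
value `toStep8 (x 0)`, by `toStep8_lineShift_p₁_mul`, together with anything independent of the
offset): EVERY digit observer guesses the datum `x₀ mod Q` with probability at most
`(Σ L + Σ_k defect(L, translation_k)) / Q`. [cite: ChenQuantumLattice2024, §3.5.9 pp. 35–37] -/
theorem residueObserver_le (hP : Odd ((p₁ * Q : ℕ+) : ℕ)) (hb : b 0 = -1)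
    (hunit : IsUnit ((2 * D * D * p₁ : ℕ) : ZQ Q))
    (t : ZQ Q → ℤ) (ht : ∀ k, ((t k : ℤ) : ZQ Q) = k)
    {Sd : Type*} [Fintype Sd] [DecidableEq Sd]
    (f : (Fin (n + 1) → ZN D p₁ Q) → Sd) (hf : ∀ k x, f (residueShift n D p₁ Q b t k x) = f x)
    (L : (Fin (n + 1) → ZN D p₁ Q) → ℝ) (g : (Fin (n + 1) → ZN D p₁ Q) × Sd → ZQ Q → ℝ)
    (hg : ∀ o a', 0 ≤ g o a') (hg1 : ∀ o, ∑ a', g o a' = 1) :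
    guessSuccess L (digitKernel n D p₁ Q b (liftV n D p₁ Q) f) g (fun x => toDatum D p₁ Q (x 0))
      ≤ ((∑ x, L x) + ∑ k, lawShiftDefect L (residueShift n D p₁ Q b t k)) / ((Q : ℕ) : ℝ) := by
  have h := digitObserver_le n D p₁ Q b hP hb hunit t ht (liftV n D p₁ Q) (residueShift n D p₁ Q b t)
    (residueShift_bijective n D p₁ Q b t) (intCast_liftV_residueShift n D p₁ Q b t) f hf L g hg hg1
  simpa only [intCast_liftV] using h

end Residue

end Register

end Literature.Computability.Cryptography.Chen2024
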